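import Summits.FinalStateConjecture.FinalStateConjecture.Theses.PhotonSphereChannels
import Literature.Geometry.Lorentzian.MinkowskiGlobalHyperbolicity
import Literature.Geometry.Lorentzian.MinkowskiCauchy
import Literature.Geometry.Lorentzian.MinkowskiCauchyDevelopment
import Literature.Geometry.Lorentzian.CauchyProblemProofs
import Literature.Geometry.Lorentzian.Hypersurface
import Literature.Geometry.Lorentzian.ChartSecondFundamentalForm
import Literature.Geometry.Lorentzian.CurvatureRegularity
import Literature.Geometry.Lorentzian.IsometryProofs

/-!
# Null terminality needs UNIFORM contraction: the pointwise version is false in Minkowski space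
(crux workfile companion of `Disproof.lean` §11c — crux `TameCensorship`, `stmt-FinalStateConjecture-10047`, line
`crush-the-swallowed-interior`, registered stub `stub_nullTerminality`; cdisprove seat, cycle 3; the same
development is proposed for landing as `Theorems/TameCensorship/Negative/NullTerminalityNeedsUniformity.lean`)

The registered stub `stub_nullTerminality` (= `NullTerminality`, repaired with the faithful `D⁺`) asks:
in a maximal vacuum Cauchy development, a maximal geodesic, null and future-directed somewhere, which
is eventually inside the faithful future domain of dependence of a closed achronal smooth spacelike
hypersurface `S″` with `H ≤ −ε < 0` UNIFORMLY, has affine domain bounded above. This file proves that the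
uniformity `ε > 0` is LOAD-BEARING: with `∃ ε > 0, ∀ y, H y ≤ −ε` weakened to `∀ y, H y < 0`
(`NullTerminalityPointwise`, everything else verbatim) the statement is FALSE —

* `not_nullTerminalityPointwiseAnyDev : ¬ NullTerminalityPointwiseAnyDev` — UNCONDITIONALLY for the
  variant quantifying over all vacuum Cauchy developments (maximality dropped as well);
* `not_nullTerminalityPointwise_of_isMaximal : Minkowski.vacuumCauchyDevelopment.IsMaximal →
  ¬ NullTerminalityPointwise` — for the verbatim variant, modulo maximality of the Minkowski development
  of the trivial datum (the tree's standing MGHD-uniqueness gap; the witness lives in Minkowski space,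
  which is that MGHD).

So any proof of `stub_nullTerminality` must use `ε > 0` quantitatively (as Hawking's bound `3/ε` does).

## The witness (all in `Minkowski.vacuumCauchyDevelopment`, carrier `E4`, metric `η`)

* the profile `u(r) = −log(1 + eʳ)` (`uprof`): `u' = −eʳ/(1+eʳ) ∈ (−1, 0)`, `u'' = −eʳ/(1+eʳ)² < 0`;
* the hypersurface `S″ = {x⁰ = u(x¹)}` = range of the graph immersion `fGraph y = u(y⁰) e₀ + (0, y)`
  (`N = E3`): closed (`isClosed_range_fGraph`), achronal (`isAchronal_range_fGraph`: a timelike curve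
  between graph points would gain time `u(q¹) − u(p¹) < |q¹ − p¹| ≤ ‖q̲ − p̲‖`), a spacelike immersion
  (`isSpacelikeImmersion_fGraph`: `η(df v, df v) = ‖v‖² − u'²(v⁰)² > 0`), with smooth future unit normal
  `ν = (1 − u'²)^{−1/2}(e₀ + u' e₁)` (`isFutureUnitNormal_νf`, `contMDiff_lift`);
* ITS MEAN CURVATURE IS NEGATIVE EVERYWHERE BUT NOT UNIFORMLY: `meanCurvature_fGraph :
  H = c u''/(1 − u'²) = u''/(1 − u'²)^{3/2}` and `meanCurvature_fGraph_neg : H < 0` — computed from the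
  tree's definitions (`secondFundamentalForm` via `secondFundamentalForm_apply_holds` and the frame
  formula `normalDerivAlong_eq` read in the constant frame of the flat development:
  `normalDerivAlong_flat : D_v ν = D(Nf)_y v`, `secondFundamentalForm_graph : K(v, w) = c u'' v⁰ w⁰`;
  the metric trace by `trace_eq_sum_gram_inv` in the standard basis, Gram matrix `diag(1 − u'², 1, 1)`);
* the faithful future domain of dependence of `S″` contains `W = {u(x¹) ≤ x⁰, x⁰ + x¹ < 0}`
  (`regionW_subset_fdod_graph`: along a past-ENDLESS causal curve of Minkowski space the time is unbounded
  below — `not_bddBelow_time_of_isFutureCausalCurveOn`, the causal twin of the tree's timelike lemma —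
  and the spatial drift is at most the elapsed time, so `t − u(x¹) ≤ (p⁰ + p¹) + log(1 + e^{t − p⁰ − p¹})`
  becomes negative and the curve meets the graph by the intermediate value theorem);
* the null LINE `ℓ(t) = (0, −1, 0, 0) + t (e₀ − e₁)` (`nullLine qBase`): a maximal geodesic of the flat
  Levi-Civita connection on all of `ℝ` (`ModelSpace.isGeodesic_line`), null and future-directed, and in
  `W` for every `t ≥ 0` (`x⁰ + x¹ ≡ −1`). Its affine domain `ℝ` is not bounded above.

Everything is proved from the tree's definitions; axioms `propext`, `Classical.choice`, `Quot.sound`.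
-/

noncomputable section

open Bundle Set Filter Function Topology
open scoped Manifold ContDiff InnerProductSpace

namespace Summit.FinalStateConjecture.FinalStateConjecture.Cruxes.TameCensorship.Disproof.Uniformity

open Literature.Geometry.Lorentzian

local notation "η₄" => (LorentzianMetric.ofLE (n' := (∞ : ℕ∞ω)) Minkowski.metric le_top)
local notation "∂ₜ" => (TimeOrientation.ofLE (n' := (∞ : ℕ∞ω)) Minkowski.timeOrientation le_top)

/-! ## S1 Past-endless causal curves of Minkowski spacetime have time unbounded below -/

/-- A past endless CAUSAL curve of Minkowski spacetime, defined on an interval, has time coordinate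
unbounded below (causal version of the tree's `Minkowski.not_bddBelow_time`). -/
theorem not_bddBelow_time_of_isFutureCausalCurveOn {γ : ℝ → E4} {s : Set ℝ} (hs : s.OrdConnected)
    (h : LorentzianMetric.IsFutureCausalCurveOn η₄ ∂ₜ γ s)
    (hend : IsPastEndless γ s) : ¬ BddBelow ((fun σ ↦ γ σ 0) '' s) := by
  intro hb
  haveI : Nonempty s := hend.nonempty.to_subtype
  have hmono : Monotone fun σ : sᵒᵈ ↦ -γ (OrderDual.ofDual σ).1 0 := by
    intro i j hij
    have := (Minkowski.strictMonoOn_time_of_isFutureCausalCurveOn hs h).monotoneOn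
      (OrderDual.ofDual j).2 (OrderDual.ofDual i).2 (OrderDual.ofDual_le_ofDual.mpr hij)
    simpa using this
  have hb' : BddAbove (range fun σ : sᵒᵈ ↦ -γ (OrderDual.ofDual σ).1 0) := by
    obtain ⟨m, hm⟩ := hb
    refine ⟨-m, ?_⟩
    rintro _ ⟨σ, rfl⟩
    have := hm ⟨(OrderDual.ofDual σ).1, (OrderDual.ofDual σ).2, rfl⟩
    simpa using this
  obtain ⟨⟨T, hT⟩, q, hq⟩ := Minkowski.tendsto_of_monotone_of_dist_le hmono hb'
    (x := fun σ : sᵒᵈ ↦ E4.spatial (γ (OrderDual.ofDual σ).1))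
    (fun i j hij ↦ by
      rw [dist_comm, dist_eq_norm]
      have := Minkowski.norm_spatial_sub_le_of_isFutureCausalCurveOn hs h (OrderDual.ofDual j).2
        (OrderDual.ofDual i).2 (OrderDual.ofDual_le_ofDual.mpr hij)
      linarith)
  have hT' : Tendsto (fun σ : sᵒᵈ ↦ γ (OrderDual.ofDual σ).1 0) atTop (𝓝 (-T)) := by
    simpa using hT.neg
  have hlim := Minkowski.tendsto_of_tendsto_time_spatial hT' hq
  exact hend.2 _ hlim

/-! ## S2 The profile `u(r) = −log(1 + eʳ)` and the region `W = {u(x¹) ≤ t, t + x¹ < 0}` -/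

/-- The profile `u(r) = −log(1 + eʳ)` (minus softplus). -/
def uprof (r : ℝ) : ℝ := -Real.log (1 + Real.exp r)

/-- `1 + eʳ > 0`. -/
theorem one_add_exp_pos (r : ℝ) : 0 < 1 + Real.exp r := by positivity

/-- `u < 0` everywhere. -/
theorem uprof_neg (r : ℝ) : uprof r < 0 := by
  unfold uprof
  have : 0 < Real.log (1 + Real.exp r) := Real.log_pos (by linarith [Real.exp_pos r])
  linarith

/-- `u` is strictly decreasing. -/
theorem uprof_strictAnti : StrictAnti uprof := by
  intro a b hab
  unfold uprof
  have ha := one_add_exp_pos a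
  have h : Real.log (1 + Real.exp a) < Real.log (1 + Real.exp b) :=
    Real.log_lt_log ha (by linarith [Real.exp_lt_exp.mpr hab])
  linarith

/-- Key estimate: `r + u(A − r)`… in the form used below: for `A < 0` and every real `τ`,
`τ − u(A − τ) = A + log(1 + e^{τ − A})`. -/
theorem sub_uprof_eq (A τ : ℝ) : τ - uprof (A - τ) = A + Real.log (1 + Real.exp (τ - A)) := by
  unfold uprof
  have h1 : 1 + Real.exp (A - τ) = Real.exp (A - τ) * (1 + Real.exp (τ - A)) := by
    rw [mul_add, mul_one, ← Real.exp_add, show A - τ + (τ - A) = 0 by ring, Real.exp_zero]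
    ring
  rw [h1, Real.log_mul (Real.exp_pos _).ne' (one_add_exp_pos _).ne', Real.log_exp]
  ring

/-- For `A < 0` there is a threshold `τ₀` below which `τ − u(A − τ) < 0`. -/
theorem exists_sub_uprof_neg {A : ℝ} (hA : A < 0) : ∃ τ₀ : ℝ, ∀ τ ≤ τ₀, τ - uprof (A - τ) < 0 := by
  -- need log(1 + e^{τ−A}) < −A, i.e. e^{τ−A} < e^{−A} − 1 (> 0)
  have hpos : 0 < Real.exp (-A) - 1 := by
    have : 1 < Real.exp (-A) := Real.one_lt_exp_iff.mpr (by linarith)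
    linarith
  refine ⟨A + Real.log ((Real.exp (-A) - 1) / 2), fun τ hτ ↦ ?_⟩
  rw [sub_uprof_eq]
  have h1 : Real.exp (τ - A) ≤ (Real.exp (-A) - 1) / 2 := by
    have : τ - A ≤ Real.log ((Real.exp (-A) - 1) / 2) := by linarith
    calc Real.exp (τ - A) ≤ Real.exp (Real.log ((Real.exp (-A) - 1) / 2)) := Real.exp_le_exp.mpr this
      _ = (Real.exp (-A) - 1) / 2 := Real.exp_log (by positivity)
  have h2 : 1 + Real.exp (τ - A) < Real.exp (-A) := by linarith
  have h3 : Real.log (1 + Real.exp (τ - A)) < -A := by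
    have := Real.log_lt_log (one_add_exp_pos _) h2
    rwa [Real.log_exp] at this
  linarith

/-- The graph `S″ = {x | x⁰ = u(x¹)}` of the profile over the spatial slices. -/
def graphSet : Set E4 := {x | x 0 = uprof (x 1)}

/-- The region `W = {u(x¹) ≤ x⁰, x⁰ + x¹ < 0}` (it will turn out to lie in `D⁺(S″)`). -/
def regionW : Set E4 := {x | uprof (x 1) ≤ x 0 ∧ x 0 + x 1 < 0}

/-- A coordinate of a vector of `E3` is bounded by its norm. -/
theorem abs_apply_le_norm_E3 (v : E3) (i : Fin 3) : |v i| ≤ ‖v‖ := by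
  rw [EuclideanSpace.norm_eq]
  apply Real.abs_le_sqrt
  have := Finset.single_le_sum (f := fun j : Fin 3 ↦ ‖v j‖ ^ 2) (fun j _ ↦ sq_nonneg _)
    (Finset.mem_univ i)
  simpa [Real.norm_eq_abs, sq_abs] using this

/-- `x¹` of a point of `E4` is the `0`-th spatial coordinate. -/
theorem spatial_apply_zero (x : E4) : E4.spatial x 0 = x 1 := by
  simp [E4.spatial]

/-- `u` is continuous. -/
theorem continuous_uprof : Continuous uprof := by
  unfold uprof
  exact ((continuous_const.add Real.continuous_exp).log fun r ↦ (one_add_exp_pos r).ne').neg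

/-- **Every point of `W` lies in the FAITHFUL future domain of dependence of the graph**: a past
endless causal curve through `p ∈ W` has time `→ −∞`, moves at most at unit speed, hence drifts
in `x¹` by at most the elapsed time; since `u` decreases, `t − u(x¹) ≤ t − u(A − t)` with
`A = p⁰ + p¹ < 0`, which is negative for `t` small enough (`exists_sub_uprof_neg`); by the
intermediate value theorem `t − u(x¹)` vanishes somewhere at or before `p`. -/
theorem regionW_subset_fdod_graph {p : E4} (hp : p ∈ regionW)
    (β : ℝ → E4) (s : Set ℝ) (hs : s.OrdConnected)
    (hβ : LorentzianMetric.IsFutureCausalCurveOn η₄ ∂ₜ β s) (hend : IsPastEndless β s)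
    {t₀ : ℝ} (ht₀ : t₀ ∈ s) (hβp : β t₀ = p) :
    ∃ t ∈ s, t ≤ t₀ ∧ β t ∈ graphSet := by
  obtain ⟨hpu, hpA⟩ := hp
  set A : ℝ := p 0 + p 1 with hA
  set φ : ℝ → ℝ := fun σ ↦ β σ 0 - uprof (β σ 1) with hφ
  -- continuity of φ on s
  have hφcont : ContinuousOn φ s := by
    intro σ hσ
    have hc : ContinuousAt β σ := (hβ σ hσ).1.continuousAt
    have h0 : ContinuousAt (fun σ ↦ β σ 0) σ :=
      ((EuclideanSpace.proj (0 : Fin 4) : E4 →L[ℝ] ℝ).continuous.continuousAt).comp hc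
    have h1 : ContinuousAt (fun σ ↦ β σ 1) σ :=
      ((EuclideanSpace.proj (1 : Fin 4) : E4 →L[ℝ] ℝ).continuous.continuousAt).comp hc
    exact (h0.sub (continuous_uprof.continuousAt.comp h1)).continuousWithinAt
  -- threshold
  obtain ⟨τ₀, hτ₀⟩ := exists_sub_uprof_neg hpA
  -- time unbounded below: a parameter σ₁ ∈ s with small time
  have hnb := not_bddBelow_time_of_isFutureCausalCurveOn hs hβ hend
  obtain ⟨σ₁, hσ₁s, hσ₁t⟩ : ∃ σ₁ ∈ s, β σ₁ 0 < min τ₀ (p 0) := by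
    by_contra hcon
    push Not at hcon
    exact hnb ⟨min τ₀ (p 0), by rintro _ ⟨σ, hσ, rfl⟩; exact hcon σ hσ⟩
  have hσ₁τ : β σ₁ 0 ≤ τ₀ := (hσ₁t.trans_le (min_le_left _ _)).le
  have hσ₁p : β σ₁ 0 < p 0 := hσ₁t.trans_le (min_le_right _ _)
  -- σ₁ < t₀ by strict monotonicity of time
  have hmono := Minkowski.strictMonoOn_time_of_isFutureCausalCurveOn hs hβ
  have hσ₁lt : σ₁ < t₀ := by
    by_contra hle
    push Not at hle
    have := hmono.monotoneOn ht₀ hσ₁s hle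
    simp only at this
    rw [hβp] at this
    linarith
  -- spatial drift bound
  have hdrift : β σ₁ 1 ≤ A - β σ₁ 0 := by
    have h1 := Minkowski.norm_spatial_sub_le_of_isFutureCausalCurveOn hs hβ hσ₁s ht₀ hσ₁lt.le
    rw [hβp] at h1
    have h2 : |(E4.spatial p - E4.spatial (β σ₁)) 0| ≤ ‖E4.spatial p - E4.spatial (β σ₁)‖ :=
      abs_apply_le_norm_E3 _ 0
    have h3 : (E4.spatial p - E4.spatial (β σ₁)) 0 = p 1 - β σ₁ 1 := by
      simp [E4.spatial]
    rw [h3] at h2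
    have h4 : -(p 1 - β σ₁ 1) ≤ |p 1 - β σ₁ 1| := neg_le_abs _
    rw [hA]
    linarith
  -- φ σ₁ < 0
  have hφσ₁ : φ σ₁ < 0 := by
    have hu : uprof (A - β σ₁ 0) ≤ uprof (β σ₁ 1) := uprof_strictAnti.antitone hdrift
    have := hτ₀ (β σ₁ 0) hσ₁τ
    simp only [hφ]
    linarith
  -- φ t₀ ≥ 0
  have hφt₀ : 0 ≤ φ t₀ := by
    simp only [hφ, hβp]
    linarith
  -- IVT on [σ₁, t₀]
  have hsub : Icc σ₁ t₀ ⊆ s := hs.out hσ₁s ht₀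
  obtain ⟨t, ht, hφt⟩ := intermediate_value_Icc hσ₁lt.le (hφcont.mono hsub) ⟨hφσ₁.le, hφt₀⟩
  refine ⟨t, hsub ht, ht.2, ?_⟩
  show β t 0 = uprof (β t 1)
  have : φ t = 0 := hφt
  simp only [hφ] at this
  linarith

/-! ## S3 The null line `ℓ(σ) = q₀ + σ (e₀ − e₁)` -/

/-- The null direction `e₀ − e₁`. -/
def nullDir : E4 := E4.basisVector 0 - E4.basisVector 1

/-- Time component of the null direction. -/
@[simp] theorem nullDir_apply_zero : nullDir 0 = 1 := by simp [nullDir]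
/-- `x¹`-component of the null direction. -/
@[simp] theorem nullDir_apply_one : nullDir 1 = -1 := by simp [nullDir]
/-- `x²`-component of the null direction. -/
@[simp] theorem nullDir_apply_two : nullDir 2 = 0 := by simp [nullDir, Fin.ext_iff]
/-- `x³`-component of the null direction. -/
@[simp] theorem nullDir_apply_three : nullDir 3 = 0 := by simp [nullDir, Fin.ext_iff]

/-- `η(e₀ − e₁, e₀ − e₁) = 0`: the direction is null. -/
theorem bilin_nullDir_nullDir : Minkowski.bilin nullDir nullDir = 0 := by
  simp [Minkowski.bilin_apply, Fin.sum_univ_three, Fin.succ_zero_eq_one, Fin.succ_one_eq_two]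

/-- The null line through `q₀`. -/
def nullLine (q₀ : E4) (σ : ℝ) : E4 := q₀ + σ • nullDir

/-- Along the null line, `x⁰ + x¹` is constant. -/
theorem nullLine_sum (q₀ : E4) (σ : ℝ) : nullLine q₀ σ 0 + nullLine q₀ σ 1 = q₀ 0 + q₀ 1 := by
  simp [nullLine]
  ring

/-- The null line is eventually in `W` if `q₀⁰ + q₀¹ < 0`: for `σ ≥ −q₀⁰`. -/
theorem nullLine_mem_regionW {q₀ : E4} (hq : q₀ 0 + q₀ 1 < 0) {σ : ℝ} (hσ : -q₀ 0 ≤ σ) :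
    nullLine q₀ σ ∈ regionW := by
  refine ⟨?_, by rw [nullLine_sum]; exact hq⟩
  have h0 : nullLine q₀ σ 0 = q₀ 0 + σ := by simp [nullLine]
  rw [h0]
  linarith [uprof_neg (nullLine q₀ σ 1)]

/-- The null line is a geodesic of the Levi-Civita connection of Minkowski spacetime, with velocity
`nullDir`. -/
theorem isGeodesic_nullLine [Minkowski.smoothMetric.toPseudoRiemannianMetric.HasLeviCivita] (q₀ : E4) :
    IsGeodesic Minkowski.smoothMetric.toPseudoRiemannianMetric.leviCivita (nullLine q₀) :=
  ModelSpace.isGeodesic_line (g := Minkowski.smoothMetric.toPseudoRiemannianMetric)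
    (G₀ := Minkowski.bilin) Minkowski.smoothMetric_val q₀ nullDir

/-- The velocity of the null line is the constant null direction. -/
theorem velocity_nullLine (q₀ : E4) (σ : ℝ) : velocity 𝓘(ℝ, E4) (nullLine q₀) σ = nullDir :=
  ModelSpace.velocity_line q₀ nullDir σ


/-! ## S4 Calculus of the profile: `u' = −eʳ/(1+eʳ) ∈ (−1, 0)`, `u'' = −eʳ/(1+eʳ)² < 0` -/

/-- `u'(r) = −eʳ/(1 + eʳ)`. -/
def uderiv (r : ℝ) : ℝ := -(Real.exp r / (1 + Real.exp r))

/-- `u''(r) = −eʳ/(1 + eʳ)²`. -/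
def uderiv2 (r : ℝ) : ℝ := -(Real.exp r / (1 + Real.exp r) ^ 2)

/-- `u' = uderiv`. -/
theorem hasDerivAt_uprof (r : ℝ) : HasDerivAt uprof (uderiv r) r := by
  unfold uprof uderiv
  have h1 : HasDerivAt (fun r ↦ 1 + Real.exp r) (Real.exp r) r := by
    simpa using (Real.hasDerivAt_exp r).const_add 1
  have h2 := h1.log (one_add_exp_pos r).ne'
  exact h2.neg

/-- `u'' = uderiv2`. -/
theorem hasDerivAt_uderiv (r : ℝ) : HasDerivAt uderiv (uderiv2 r) r := by
  have h0 : (1 + Real.exp r) ≠ 0 := (one_add_exp_pos r).ne'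
  have h1 : HasDerivAt (fun r ↦ 1 + Real.exp r) (Real.exp r) r := by
    simpa using (Real.hasDerivAt_exp r).const_add 1
  have h2 := (Real.hasDerivAt_exp r).div h1 h0
  have h3 : HasDerivAt (fun x ↦ -(Real.exp x / (1 + Real.exp x)))
      (-((Real.exp r * (1 + Real.exp r) - Real.exp r * Real.exp r) / (1 + Real.exp r) ^ 2)) r :=
    h2.neg
  have h4 : HasDerivAt uderiv
      (-((Real.exp r * (1 + Real.exp r) - Real.exp r * Real.exp r) / (1 + Real.exp r) ^ 2)) r := h3
  refine h4.congr_deriv ?_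
  unfold uderiv2
  field_simp
  ring

/-- `u' < 0`. -/
theorem uderiv_lt_zero (r : ℝ) : uderiv r < 0 := by
  unfold uderiv
  have := div_pos (Real.exp_pos r) (one_add_exp_pos r)
  linarith

/-- `−1 < u'`. -/
theorem neg_one_lt_uderiv (r : ℝ) : -1 < uderiv r := by
  unfold uderiv
  have h : Real.exp r / (1 + Real.exp r) < 1 := by
    rw [div_lt_one (one_add_exp_pos r)]
    linarith
  linarith

/-- `|u'| < 1` (the graph is spacelike). -/
theorem abs_uderiv_lt_one (r : ℝ) : |uderiv r| < 1 :=
  abs_lt.mpr ⟨neg_one_lt_uderiv r, (uderiv_lt_zero r).trans one_pos⟩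

/-- `u'² < 1`. -/
theorem uderiv_sq_lt_one (r : ℝ) : uderiv r ^ 2 < 1 := by
  have := abs_uderiv_lt_one r
  have h2 : uderiv r ^ 2 = |uderiv r| ^ 2 := (sq_abs _).symm
  rw [h2]
  nlinarith [abs_nonneg (uderiv r)]

/-- `1 − u'² > 0`. -/
theorem one_sub_uderiv_sq_pos (r : ℝ) : 0 < 1 - uderiv r ^ 2 := by
  linarith [uderiv_sq_lt_one r]

/-- `u'' < 0` (the profile is concave: the graph contracts). -/
theorem uderiv2_lt_zero (r : ℝ) : uderiv2 r < 0 := by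
  unfold uderiv2
  have := div_pos (Real.exp_pos r) (pow_pos (one_add_exp_pos r) 2)
  linarith

/-- `u` is differentiable. -/
theorem differentiable_uprof : Differentiable ℝ uprof := fun r ↦ (hasDerivAt_uprof r).differentiableAt
/-- `u'` is differentiable. -/
theorem differentiable_uderiv : Differentiable ℝ uderiv := fun r ↦ (hasDerivAt_uderiv r).differentiableAt

/-- `u` is smooth (any order). -/
theorem contDiff_uprof {m : ℕ∞ω} : ContDiff ℝ m uprof := by
  unfold uprof
  have h1 : ContDiff ℝ m (fun r : ℝ ↦ 1 + Real.exp r) := contDiff_const.add Real.contDiff_exp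
  exact (h1.log fun r ↦ (one_add_exp_pos r).ne').neg

/-- `u'` is smooth (any order). -/
theorem contDiff_uderiv {m : ℕ∞ω} : ContDiff ℝ m uderiv := by
  unfold uderiv
  have h1 : ContDiff ℝ m (fun r : ℝ ↦ 1 + Real.exp r) := contDiff_const.add Real.contDiff_exp
  exact (Real.contDiff_exp.div h1 fun r ↦ (one_add_exp_pos r).ne').neg

/-- Strict `1`-Lipschitz: `|u(a) − u(b)| < |a − b|` for `a ≠ b` (mean value theorem, `|u'| < 1`). -/
theorem abs_uprof_sub_lt {a b : ℝ} (hab : a ≠ b) : |uprof a - uprof b| < |a - b| := by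
  wlog h : b < a generalizing a b
  · have h' : a < b := lt_of_le_of_ne (not_lt.mp h) hab
    have := this hab.symm h'
    rwa [abs_sub_comm, abs_sub_comm a b]
  obtain ⟨ξ, -, hξ⟩ := exists_hasDerivAt_eq_slope uprof uderiv h
    (differentiable_uprof.continuous.continuousOn) (fun x _ ↦ hasDerivAt_uprof x)
  have hpos : 0 < a - b := sub_pos.mpr h
  rw [abs_of_pos hpos]
  have : uprof a - uprof b = uderiv ξ * (a - b) := by
    rw [hξ]; field_simp
  rw [this, abs_mul, abs_of_pos hpos]
  calc |uderiv ξ| * (a - b) < 1 * (a - b) := mul_lt_mul_of_pos_right (abs_uderiv_lt_one ξ) hpos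
    _ = a - b := one_mul _

/-- The normalisation factor `c(r) = (1 − u'(r)²)^{−1/2} > 0`. -/
def cfac (r : ℝ) : ℝ := (Real.sqrt (1 - uderiv r ^ 2))⁻¹

/-- `c > 0`. -/
theorem cfac_pos (r : ℝ) : 0 < cfac r :=
  inv_pos.mpr (Real.sqrt_pos.mpr (one_sub_uderiv_sq_pos r))

/-- `c² (1 − u'²) = 1`. -/
theorem cfac_sq_mul (r : ℝ) : cfac r ^ 2 * (1 - uderiv r ^ 2) = 1 := by
  unfold cfac
  rw [inv_pow, Real.sq_sqrt (one_sub_uderiv_sq_pos r).le, inv_mul_cancel₀ (one_sub_uderiv_sq_pos r).ne']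

/-- `c` is differentiable (its derivative is never needed explicitly). -/
theorem differentiable_cfac : Differentiable ℝ cfac := by
  unfold cfac
  refine Differentiable.inv ?_ fun r ↦ (Real.sqrt_pos.mpr (one_sub_uderiv_sq_pos r)).ne'
  exact ((differentiable_const (1 : ℝ)).sub (differentiable_uderiv.pow 2)).sqrt
    fun r ↦ (one_sub_uderiv_sq_pos r).ne'

/-! ## S5 The immersion `f(y) = (u(y⁰), y)`, its tangent vectors, its unit normal field -/

/-- The spatial embedding `y ↦ (0, y)` as a continuous linear map `E3 →L[ℝ] E4`. -/
def sEmb : E3 →L[ℝ] E4 :=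
  ∑ i : Fin 3, (EuclideanSpace.proj i : E3 →L[ℝ] ℝ).smulRight (E4.basisVector i.succ)

/-- `(0, y)` has time component `0`. -/
@[simp] theorem sEmb_apply_zero (y : E3) : sEmb y 0 = 0 := by
  simp [sEmb, Fin.sum_univ_three]

/-- `(0, y)` has spatial components `y`. -/
@[simp] theorem sEmb_apply_succ (y : E3) (i : Fin 3) : sEmb y i.succ = y i := by
  fin_cases i <;> simp [sEmb, Fin.sum_univ_three, Fin.ext_iff]

/-- The graph immersion `f(y) = u(y⁰) e₀ + (0, y)`. -/
def fGraph (y : E3) : E4 := uprof (y 0) • E4.basisVector 0 + sEmb y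

/-- Time component of the graph point: `u(y⁰)`. -/
@[simp] theorem fGraph_apply_zero (y : E3) : fGraph y 0 = uprof (y 0) := by
  simp [fGraph]

/-- Spatial components of the graph point: `y`. -/
@[simp] theorem fGraph_apply_succ (y : E3) (i : Fin 3) : fGraph y i.succ = y i := by
  simp [fGraph, Fin.succ_ne_zero]

/-- The differential of the graph map at `y`: `v ↦ (u'(y⁰) v⁰) e₀ + (0, v)`. -/
def dfGraph (y : E3) : E3 →L[ℝ] E4 :=
  ((uderiv (y 0)) • (EuclideanSpace.proj (0 : Fin 3) : E3 →L[ℝ] ℝ)).smulRight (E4.basisVector 0) + sEmb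

/-- `df_y v = (u'(y⁰) v⁰) e₀ + (0, v)`. -/
theorem dfGraph_apply (y v : E3) : dfGraph y v = (uderiv (y 0) * v 0) • E4.basisVector 0 + sEmb v := by
  simp [dfGraph]

/-- Time component of `df_y v`. -/
@[simp] theorem dfGraph_apply_zero (y v : E3) : dfGraph y v 0 = uderiv (y 0) * v 0 := by
  rw [dfGraph_apply]; simp

/-- Spatial components of `df_y v`. -/
@[simp] theorem dfGraph_apply_succ (y v : E3) (i : Fin 3) : dfGraph y v i.succ = v i := by
  rw [dfGraph_apply]; simp [Fin.succ_ne_zero]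

/-- The graph map has derivative `dfGraph`. -/
theorem hasFDerivAt_fGraph (y : E3) : HasFDerivAt fGraph (dfGraph y) y := by
  have h0 : HasFDerivAt (fun y : E3 ↦ y 0) (EuclideanSpace.proj (0 : Fin 3) : E3 →L[ℝ] ℝ) y :=
    (EuclideanSpace.proj (0 : Fin 3) : E3 →L[ℝ] ℝ).hasFDerivAt
  have h1' := (hasDerivAt_uprof (y 0)).comp_hasFDerivAt y h0
  have h1 : HasFDerivAt (fun y : E3 ↦ uprof (y 0))
      ((uderiv (y 0)) • (EuclideanSpace.proj (0 : Fin 3) : E3 →L[ℝ] ℝ)) y := by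
    simpa only [Function.comp_def] using h1'
  have h2 := h1.smul_const (E4.basisVector 0)
  exact h2.add sEmb.hasFDerivAt

/-- The graph map is differentiable. -/
theorem differentiable_fGraph : Differentiable ℝ fGraph := fun y ↦ (hasFDerivAt_fGraph y).differentiableAt

/-- `fderiv` of the graph map. -/
theorem fderiv_fGraph (y : E3) : fderiv ℝ fGraph y = dfGraph y := (hasFDerivAt_fGraph y).fderiv

/-- The graph map is smooth (any order). -/
theorem contDiff_fGraph {m : ℕ∞ω} : ContDiff ℝ m fGraph := by
  unfold fGraph
  have h0 : ContDiff ℝ m (fun y : E3 ↦ y 0) := contDiff_piLp_apply (p := 2) (i := (0 : Fin 3))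
  exact ((contDiff_uprof.comp h0).smul contDiff_const).add sEmb.contDiff

/-- `η(df v, df w) = ⟪v, w⟫ − u'² v⁰ w⁰`. -/
theorem bilin_dfGraph (y v w : E3) :
    Minkowski.bilin (dfGraph y v) (dfGraph y w) = ⟪v, w⟫_ℝ - uderiv (y 0) ^ 2 * (v 0 * w 0) := by
  rw [Minkowski.bilin_apply]
  simp only [dfGraph_apply_zero, dfGraph_apply_succ]
  have : ⟪v, w⟫_ℝ = ∑ i : Fin 3, v i * w i := by
    rw [EuclideanSpace.inner_eq_star_dotProduct]
    simp [dotProduct, Fin.sum_univ_three, mul_comm]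
  rw [this]
  ring

/-- Positivity of the induced form: `η(df v, df v) ≥ (1 − u'²)‖v‖² > 0` for `v ≠ 0`. -/
theorem bilin_dfGraph_self_pos (y : E3) {v : E3} (hv : v ≠ 0) :
    0 < Minkowski.bilin (dfGraph y v) (dfGraph y v) := by
  rw [bilin_dfGraph, real_inner_self_eq_norm_sq]
  have h1 : v 0 ^ 2 ≤ ‖v‖ ^ 2 := by
    have := abs_apply_le_norm_E3 v 0
    calc v 0 ^ 2 = |v 0| ^ 2 := (sq_abs _).symm
      _ ≤ ‖v‖ ^ 2 := pow_le_pow_left₀ (abs_nonneg _) this 2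
  have h2 : 0 < ‖v‖ ^ 2 := by positivity
  have h3 := uderiv_sq_lt_one (y 0)
  have h4 : 0 ≤ uderiv (y 0) ^ 2 := sq_nonneg _
  nlinarith

/-- The raw normal `n(r) = e₀ + u'(r) e₁` and the unit normal `N(r) = c(r) n(r)`. -/
def nraw (r : ℝ) : E4 := E4.basisVector 0 + uderiv r • E4.basisVector 1

/-- The unit normal `N(r) = c(r) n(r)` as a function of `r = y⁰`. -/
def nvec (r : ℝ) : E4 := cfac r • nraw r

/-- The normal field along `fGraph`: `ν(y) = N(y⁰)`. -/
def Nf (y : E3) : E4 := nvec (y 0)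

/-- Time component of the raw normal. -/
@[simp] theorem nraw_apply_zero (r : ℝ) : nraw r 0 = 1 := by simp [nraw]
/-- `x¹`-component of the raw normal. -/
@[simp] theorem nraw_apply_one (r : ℝ) : nraw r 1 = uderiv r := by simp [nraw]
/-- `x²`-component of the raw normal. -/
@[simp] theorem nraw_apply_two (r : ℝ) : nraw r 2 = 0 := by simp [nraw, Fin.ext_iff]
/-- `x³`-component of the raw normal. -/
@[simp] theorem nraw_apply_three (r : ℝ) : nraw r 3 = 0 := by simp [nraw, Fin.ext_iff]

/-- `η(n, df v) = 0`: the raw normal is normal. -/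
theorem bilin_nraw_dfGraph (y v : E3) : Minkowski.bilin (nraw (y 0)) (dfGraph y v) = 0 := by
  rw [Minkowski.bilin_apply]
  simp [Fin.sum_univ_three, Fin.succ_zero_eq_one, Fin.succ_one_eq_two]

/-- `η(n, n) = −(1 − u'²)`. -/
theorem bilin_nraw_nraw (r : ℝ) : Minkowski.bilin (nraw r) (nraw r) = -(1 - uderiv r ^ 2) := by
  rw [Minkowski.bilin_apply]
  simp [Fin.sum_univ_three, Fin.succ_zero_eq_one, Fin.succ_one_eq_two]
  ring

/-- `η(N, df v) = 0`: `N` is normal to the graph. -/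
theorem bilin_Nf_dfGraph (y v : E3) : Minkowski.bilin (Nf y) (dfGraph y v) = 0 := by
  unfold Nf nvec
  simp only [map_smul, FunLike.coe_smul, Pi.smul_apply, bilin_nraw_dfGraph, smul_zero]

/-- `η(N, N) = −1`: `N` is a timelike unit vector. -/
theorem bilin_Nf_Nf (y : E3) : Minkowski.bilin (Nf y) (Nf y) = -1 := by
  unfold Nf nvec
  simp only [map_smul, FunLike.coe_smul, Pi.smul_apply, smul_eq_mul, bilin_nraw_nraw]
  have := cfac_sq_mul (y 0)
  nlinarith [this]

/-- `η(e₀, N) = −c < 0`: the normal is future-directed. -/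
theorem bilin_e0_Nf (y : E3) : Minkowski.bilin (E4.basisVector 0) (Nf y) < 0 := by
  rw [Minkowski.bilin_basisVector_zero_left]
  unfold Nf nvec
  simp [cfac_pos (y 0)]


/-! ## S6 The derivative of the normal field; the second fundamental form in the flat development -/

theorem hasDerivAt_nraw (r : ℝ) : HasDerivAt nraw (uderiv2 r • E4.basisVector 1) r := by
  unfold nraw
  have h := ((hasDerivAt_uderiv r).smul_const (E4.basisVector 1)).const_add (E4.basisVector 0)
  exact h

/-- `N' = c n' + c' n` (the value of `c'` is never needed). -/
def nvecDeriv (r : ℝ) : E4 := cfac r • (uderiv2 r • E4.basisVector 1) + deriv cfac r • nraw r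

/-- `N' = nvecDeriv`. -/
theorem hasDerivAt_nvec (r : ℝ) : HasDerivAt nvec (nvecDeriv r) r :=
  ((differentiable_cfac r).hasDerivAt).smul (hasDerivAt_nraw r)

/-- `N` is differentiable. -/
theorem differentiable_nvec : Differentiable ℝ nvec := fun r ↦ (hasDerivAt_nvec r).differentiableAt

/-- The normal field has derivative `v ↦ v⁰ N'(y⁰)`. -/
theorem hasFDerivAt_Nf (y : E3) :
    HasFDerivAt Nf ((EuclideanSpace.proj (0 : Fin 3) : E3 →L[ℝ] ℝ).smulRight (nvecDeriv (y 0))) y := by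
  have h0 : HasFDerivAt (fun y : E3 ↦ y 0) (EuclideanSpace.proj (0 : Fin 3) : E3 →L[ℝ] ℝ) y :=
    (EuclideanSpace.proj (0 : Fin 3) : E3 →L[ℝ] ℝ).hasFDerivAt
  have h1 := ((hasDerivAt_nvec (y 0)).hasFDerivAt).comp y h0
  have h2 : HasFDerivAt (fun y : E3 ↦ nvec (y 0))
      ((EuclideanSpace.proj (0 : Fin 3) : E3 →L[ℝ] ℝ).smulRight (nvecDeriv (y 0))) y := by
    refine h1.congr_fderiv ?_
    ext v
    simp
  exact h2

/-- The normal field is differentiable. -/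
theorem differentiable_Nf : Differentiable ℝ Nf := fun y ↦ (hasFDerivAt_Nf y).differentiableAt

/-- `D(Nf)_y v = v⁰ N'(y⁰)`. -/
theorem fderiv_Nf_apply (y v : E3) : fderiv ℝ Nf y v = (v 0) • nvecDeriv (y 0) := by
  rw [(hasFDerivAt_Nf y).fderiv]
  simp

/-- `η(N', df w) = c u'' w⁰` (normality `η(n, df w) = 0` kills the `c'` term; `η(e₁, df w) = w⁰`). -/
theorem bilin_nvecDeriv_dfGraph (y w : E3) :
    Minkowski.bilin (nvecDeriv (y 0)) (dfGraph y w) = cfac (y 0) * uderiv2 (y 0) * w 0 := by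
  unfold nvecDeriv
  rw [map_add]
  simp only [map_smul, add_apply, FunLike.coe_smul, Pi.smul_apply,
    smul_eq_mul, bilin_nraw_dfGraph, mul_zero, add_zero]
  have : Minkowski.bilin (E4.basisVector 1) (dfGraph y w) = w 0 := by
    rw [Minkowski.bilin_apply]
    simp [Fin.sum_univ_three, Fin.succ_zero_eq_one, Fin.succ_one_eq_two]
  rw [this]
  ring

section Flat

local notation "gη" => (Minkowski.smoothMetric.toPseudoRiemannianMetric :
  PseudoRiemannianMetric 𝓘(ℝ, E4) ∞ E4 (TangentSpace 𝓘(ℝ, E4) : E4 → Type _))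

variable [Minkowski.smoothMetric.toPseudoRiemannianMetric.HasLeviCivita]

/-- The normal field along the graph, as a field of tangent vectors of the development. -/
def νf : NormalField 𝓘(ℝ, E4) fGraph := fun y ↦ (Nf y : E4)

omit [Minkowski.smoothMetric.toPseudoRiemannianMetric.HasLeviCivita] in
/-- The graph map is differentiable as a map of manifolds. -/
theorem mdifferentiableAt_fGraph (y : E3) : MDifferentiableAt 𝓘(ℝ, E3) 𝓘(ℝ, E4) fGraph y :=
  mdifferentiableAt_iff_differentiableAt.mpr (differentiable_fGraph y)

omit [Minkowski.smoothMetric.toPseudoRiemannianMetric.HasLeviCivita] in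
/-- `mfderiv` of the graph map is `dfGraph`. -/
theorem mfderiv_fGraph (y : E3) : mfderiv 𝓘(ℝ, E3) 𝓘(ℝ, E4) fGraph y = dfGraph y := by
  rw [mfderiv_eq_fderiv, fderiv_fGraph]

omit [Minkowski.smoothMetric.toPseudoRiemannianMetric.HasLeviCivita] in
/-- The lift `y ↦ (f y, ν y) ∈ TE4` is differentiable (trivial tangent bundle of the model space). -/
theorem mdifferentiableAt_lift (y : E3) :
    MDifferentiableAt 𝓘(ℝ, E3) 𝓘(ℝ, E4).tangent
      (fun x ↦ (TotalSpace.mk' E4 (fGraph x) (νf x) : TangentBundle 𝓘(ℝ, E4) E4)) y := by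
  refine (mdifferentiableAt_totalSpace _ _).2 ⟨mdifferentiableAt_fGraph y, ?_⟩
  simp only [trivializationAt_model_space_apply]
  exact mdifferentiableAt_iff_differentiableAt.mpr (differentiable_Nf y)

omit [Minkowski.smoothMetric.toPseudoRiemannianMetric.HasLeviCivita] in
/-- The lift `y ↦ (f y, ν y) ∈ TE4` is smooth. -/
theorem contMDiff_lift :
    ContMDiff 𝓘(ℝ, E3) 𝓘(ℝ, E4).tangent ∞
      (fun x ↦ (TotalSpace.mk' E4 (fGraph x) (νf x) : TangentBundle 𝓘(ℝ, E4) E4)) := by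
  have hf : ContMDiff 𝓘(ℝ, E3) 𝓘(ℝ, E4) ∞ fGraph := contMDiff_iff_contDiff.mpr contDiff_fGraph
  have hN : ContMDiff 𝓘(ℝ, E3) 𝓘(ℝ, E4) ∞ Nf := by
    refine contMDiff_iff_contDiff.mpr ?_
    unfold Nf nvec cfac nraw
    have h0 : ContDiff ℝ ∞ (fun y : E3 ↦ y 0) := contDiff_piLp_apply (p := 2) (i := (0 : Fin 3))
    have hc : ContDiff ℝ ∞ (fun r : ℝ ↦ (Real.sqrt (1 - uderiv r ^ 2))⁻¹) := by
      refine ContDiff.inv ?_ fun r ↦ (Real.sqrt_pos.mpr (one_sub_uderiv_sq_pos r)).ne'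
      exact (contDiff_const.sub (contDiff_uderiv.pow 2)).sqrt fun r ↦ (one_sub_uderiv_sq_pos r).ne'
    have hn : ContDiff ℝ ∞ (fun r : ℝ ↦ E4.basisVector 0 + uderiv r • E4.basisVector 1) :=
      contDiff_const.add (contDiff_uderiv.smul contDiff_const)
    exact (hc.comp h0).smul (hn.comp h0)
  intro y
  rw [contMDiffAt_totalSpace]
  refine ⟨hf y, ?_⟩
  simp only [trivializationAt_model_space_apply]
  exact hN y

/-- **`D_v ν = DN(y) v` in the flat development** (the model-space reading of the frame formula
`normalDerivAlong_eq`: constant frame, constant coefficient functionals, `∇ ∂ᵢ = 0`). -/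
theorem normalDerivAlong_flat (y : E3) (v : E3) :
    PseudoRiemannianMetric.normalDerivAlong (I' := 𝓘(ℝ, E3)) gη fGraph νf y v = fderiv ℝ Nf y v := by
  have hlift := mdifferentiableAt_lift y
  rw [PseudoRiemannianMetric.normalDerivAlong_eq gη (I' := 𝓘(ℝ, E3))
    BoundarylessManifold.isInteriorPoint hlift v]
  set b := Module.finBasis ℝ E4 with hb
  have h1 : ∀ i, mfderiv 𝓘(ℝ, E3) 𝓘(ℝ, ℝ) (fun x : E3 ↦
      (trivializationAt E4 (TangentSpace 𝓘(ℝ, E4) : E4 → Type _) (fGraph y)).localFrame_coeff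
        𝓘(ℝ, E4) b i (fGraph x) (νf x)) y v = b.repr (fderiv ℝ Nf y v) i := by
    intro i
    set L : E4 →L[ℝ] ℝ := LinearMap.toContinuousLinearMap (b.coord i) with hL
    have hrep : (fun x : E3 ↦ (trivializationAt E4 (TangentSpace 𝓘(ℝ, E4) : E4 → Type _)
        (fGraph y)).localFrame_coeff 𝓘(ℝ, E4) b i (fGraph x) (νf x)) = L ∘ Nf := by
      funext x
      rw [Function.comp_apply, ModelSpace.localFrame_coeff_trivializationAt]
      rfl
    have hd : HasFDerivAt (L ∘ Nf) (L.comp (fderiv ℝ Nf y)) y :=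
      L.hasFDerivAt.comp _ (differentiable_Nf y).hasFDerivAt
    rw [hrep, mfderiv_eq_fderiv, hd.fderiv]
    rfl
  have h2 : ∀ i, (trivializationAt E4 (TangentSpace 𝓘(ℝ, E4) : E4 → Type _) (fGraph y)).localFrame
      b i (fGraph y) = b i := fun i ↦ by
    rw [ModelSpace.localFrame_trivializationAt]
  have h4 : ∀ i, PseudoRiemannianMetric.leviCivita gη ((trivializationAt E4
      (TangentSpace 𝓘(ℝ, E4) : E4 → Type _) (fGraph y)).localFrame b i) (fGraph y)
        (mfderiv 𝓘(ℝ, E3) 𝓘(ℝ, E4) fGraph y v) = 0 := fun i ↦ by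
    rw [ModelSpace.localFrame_trivializationAt,
      ModelSpace.leviCivita_const (g := gη) Minkowski.smoothMetric_val (fGraph y) (b i)]
    rfl
  refine Eq.trans (b := ∑ i, (b.repr (fderiv ℝ Nf y v) i) • (b i : E4) +
    ∑ _i : Fin (Module.finrank ℝ E4), (0 : E4)) ?_ ?_
  · congr 1
    · refine Finset.sum_congr rfl fun i _ ↦ ?_
      rw [h2 i]
      exact congrArg (fun c : ℝ ↦ c • (b i : E4)) (h1 i)
    · refine Finset.sum_congr rfl fun i _ ↦ ?_
      rw [h4 i, smul_zero]
      rfl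
  · rw [b.sum_repr, Finset.sum_const_zero, add_zero]

/-- **The second fundamental form of the graph**: `K_ν(v, w) = η(DN(y) v, df_y w) = c u'' v⁰ w⁰`. -/
theorem secondFundamentalForm_graph (y : E3) (v w : E3) :
    PseudoRiemannianMetric.secondFundamentalForm 𝓘(ℝ, E3) gη fGraph νf y v w =
      cfac (y 0) * uderiv2 (y 0) * (v 0 * w 0) := by
  rw [PseudoRiemannianMetric.secondFundamentalForm_apply_holds (g := gη) (I' := 𝓘(ℝ, E3))
    BoundarylessManifold.isInteriorPoint (mdifferentiableAt_lift y) v w,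
    normalDerivAlong_flat, mfderiv_fGraph, fderiv_Nf_apply]
  show Minkowski.bilin ((v 0) • nvecDeriv (y 0)) (dfGraph y w) = _
  rw [map_smul, FunLike.coe_smul, Pi.smul_apply, smul_eq_mul, bilin_nvecDeriv_dfGraph]
  ring


/-! ### Stage D: the induced metric is `diag(1 − u'², 1, 1)` in the standard basis; the mean curvature -/

omit [Minkowski.smoothMetric.toPseudoRiemannianMetric.HasLeviCivita] in
/-- Smoothness of pullbacks of bilinear forms along maps `E3 → E4` (the tree's theorem). -/
theorem hpbE : PseudoRiemannianMetric.contMDiff_pullbackBilin (𝓡 4) E4 (𝓡 3) E3 ∞ :=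
  PseudoRiemannianMetric.contMDiff_pullbackBilin_holds

omit [Minkowski.smoothMetric.toPseudoRiemannianMetric.HasLeviCivita] in
/-- The induced form of the graph: `⟪v, w⟫ − u'² v⁰ w⁰`. -/
theorem inducedBilin_fGraph (y v w : E3) :
    PseudoRiemannianMetric.inducedBilin 𝓘(ℝ, E3) gη fGraph y v w =
      ⟪v, w⟫_ℝ - uderiv (y 0) ^ 2 * (v 0 * w 0) := by
  rw [PseudoRiemannianMetric.inducedBilin_apply, mfderiv_fGraph]
  exact bilin_dfGraph y v w

omit [Minkowski.smoothMetric.toPseudoRiemannianMetric.HasLeviCivita] in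
/-- **The graph is a spacelike immersion** of the flat development. -/
theorem isSpacelikeImmersion_fGraph : PseudoRiemannianMetric.IsSpacelikeImmersion (𝓡 3) gη fGraph := by
  refine ⟨contMDiff_iff_contDiff.mpr contDiff_fGraph, fun y v hv ↦ ?_⟩
  rw [PseudoRiemannianMetric.inducedBilin_apply, mfderiv_fGraph]
  exact bilin_dfGraph_self_pos y hv

/-- The standard basis of `E3`. -/
def stdB : Module.Basis (Fin 3) ℝ E3 := (EuclideanSpace.basisFun (Fin 3) ℝ).toBasis

omit [Minkowski.smoothMetric.toPseudoRiemannianMetric.HasLeviCivita] in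
/-- The standard basis vectors are the `EuclideanSpace.single i 1`. -/
@[simp] theorem stdB_apply (i : Fin 3) : stdB i = EuclideanSpace.single i (1 : ℝ) := by
  simp [stdB]

/-- The diagonal of the induced metric in the standard basis. -/
def dDiag (y : E3) (i : Fin 3) : ℝ := if i = 0 then 1 - uderiv (y 0) ^ 2 else 1

omit [Minkowski.smoothMetric.toPseudoRiemannianMetric.HasLeviCivita] in
/-- The diagonal entries are nonzero. -/
theorem dDiag_ne_zero (y : E3) (i : Fin 3) : dDiag y i ≠ 0 := by
  unfold dDiag
  split_ifs
  · exact (one_sub_uderiv_sq_pos (y 0)).ne'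
  · exact one_ne_zero

omit [Minkowski.smoothMetric.toPseudoRiemannianMetric.HasLeviCivita] in
/-- The Gram matrix of the induced metric in the standard basis is `diag(1 − u'², 1, 1)`. -/
theorem gram_fGraph (y : E3) :
    (Matrix.of fun i j ↦ (PseudoRiemannianMetric.inducedMetric gη fGraph hpbE
      isSpacelikeImmersion_fGraph).val y (stdB i) (stdB j)) = Matrix.diagonal (dDiag y) := by
  ext i j
  rw [Matrix.of_apply, PseudoRiemannianMetric.inducedMetric_val, inducedBilin_fGraph, Matrix.diagonal_apply]
  fin_cases i <;> fin_cases j <;> simp [dDiag, EuclideanSpace.inner_single_left]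

omit [Minkowski.smoothMetric.toPseudoRiemannianMetric.HasLeviCivita] in
/-- The inverse Gram matrix is `diag((1 − u'²)⁻¹, 1, 1)`. -/
theorem gram_fGraph_inv (y : E3) :
    (Matrix.of fun i j ↦ (PseudoRiemannianMetric.inducedMetric gη fGraph hpbE
      isSpacelikeImmersion_fGraph).val y (stdB i) (stdB j))⁻¹ = Matrix.diagonal fun i ↦ (dDiag y i)⁻¹ := by
  rw [gram_fGraph]
  apply Matrix.inv_eq_left_inv
  rw [Matrix.diagonal_mul_diagonal, ← Matrix.diagonal_one]
  congr 1
  funext i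
  exact inv_mul_cancel₀ (dDiag_ne_zero y i)

/-- **The mean curvature of the graph**: `H = c u''/(1 − u'²) = u''/(1 − u'²)^{3/2}`. -/
theorem meanCurvature_fGraph (y : E3) :
    PseudoRiemannianMetric.meanCurvature gη fGraph hpbE isSpacelikeImmersion_fGraph νf y =
      cfac (y 0) * uderiv2 (y 0) / (1 - uderiv (y 0) ^ 2) := by
  rw [PseudoRiemannianMetric.meanCurvature,
    trace_eq_sum_gram_inv (PseudoRiemannianMetric.inducedMetric gη fGraph hpbE isSpacelikeImmersion_fGraph)
      y stdB]
  have hent : ∀ i j : Fin 3, (Matrix.of fun i j ↦ (PseudoRiemannianMetric.inducedMetric gη fGraph hpbE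
      isSpacelikeImmersion_fGraph).val y (stdB i) (stdB j))⁻¹ j i = if j = i then (dDiag y i)⁻¹ else 0 := by
    intro i j
    rw [gram_fGraph_inv, Matrix.diagonal_apply]
    split_ifs with h
    · rw [h]
    · rfl
  have hb : ∀ i : Fin 3, (stdB i) 0 = if i = 0 then 1 else 0 := by
    intro i
    fin_cases i <;> simp [stdB]
  show ∑ i, ∑ j, (Matrix.of fun i j ↦ (PseudoRiemannianMetric.inducedMetric gη fGraph hpbE
      isSpacelikeImmersion_fGraph).val y (stdB i) (stdB j))⁻¹ j i *
        PseudoRiemannianMetric.secondFundamentalForm 𝓘(ℝ, E3) gη fGraph νf y (stdB i) (stdB j) = _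
  have hterm : ∀ i j : Fin 3, (Matrix.of fun i j ↦ (PseudoRiemannianMetric.inducedMetric gη fGraph hpbE
      isSpacelikeImmersion_fGraph).val y (stdB i) (stdB j))⁻¹ j i *
        PseudoRiemannianMetric.secondFundamentalForm 𝓘(ℝ, E3) gη fGraph νf y (stdB i) (stdB j) =
      (if j = i then (dDiag y i)⁻¹ else 0) * (cfac (y 0) * uderiv2 (y 0) *
        ((if i = 0 then (1 : ℝ) else 0) * (if j = 0 then (1 : ℝ) else 0))) := by
    intro i j
    rw [hent i j, secondFundamentalForm_graph, hb i, hb j]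
  rw [Finset.sum_congr rfl fun i _ ↦ Finset.sum_congr rfl fun j _ ↦ hterm i j]
  simp only [Fin.sum_univ_three, dDiag]
  simp
  field_simp

/-- **The graph is contracting everywhere, `H < 0`** — but NOT uniformly (`H → 0⁻` as `y⁰ → −∞`;
this file only needs the sign). -/
theorem meanCurvature_fGraph_neg (y : E3) :
    PseudoRiemannianMetric.meanCurvature gη fGraph hpbE isSpacelikeImmersion_fGraph νf y < 0 := by
  rw [meanCurvature_fGraph]
  exact div_neg_of_neg_of_pos (mul_neg_of_pos_of_neg (cfac_pos _) (uderiv2_lt_zero _))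
    (one_sub_uderiv_sq_pos _)

end Flat

/-! ## S7 Packaging: closedness, achronality, unit normal; the refutation -/

theorem range_fGraph : Set.range fGraph = graphSet := by
  ext x
  constructor
  · rintro ⟨y, rfl⟩
    show fGraph y 0 = uprof (fGraph y 1)
    rw [fGraph_apply_zero, show (1 : Fin 4) = (0 : Fin 3).succ from rfl, fGraph_apply_succ]
  · intro hx
    refine ⟨E4.spatial x, ?_⟩
    ext i
    refine Fin.cases ?_ (fun j ↦ ?_) i
    · rw [fGraph_apply_zero]
      have : E4.spatial x 0 = x 1 := by simp [E4.spatial]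
      rw [this]
      exact hx.symm
    · rw [fGraph_apply_succ]
      simp [E4.spatial]

/-- The graph is closed. -/
theorem isClosed_graphSet : IsClosed graphSet := by
  have h0 : Continuous fun x : E4 ↦ x 0 := (EuclideanSpace.proj (0 : Fin 4) : E4 →L[ℝ] ℝ).continuous
  have h1 : Continuous fun x : E4 ↦ x 1 := (EuclideanSpace.proj (1 : Fin 4) : E4 →L[ℝ] ℝ).continuous
  exact isClosed_eq h0 (continuous_uprof.comp h1)

/-- The range of the graph map is closed. -/
theorem isClosed_range_fGraph : IsClosed (Set.range fGraph) := by
  rw [range_fGraph]; exact isClosed_graphSet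

/-- **The graph is achronal** in Minkowski spacetime: a timelike curve between two graph points would
gain time `q⁰ − p⁰ = u(q¹) − u(p¹) < |q¹ − p¹| ≤ ‖q̲ − p̲‖`, against "timelike curves stay in the cone". -/
theorem isAchronal_range_fGraph : LorentzianMetric.IsAchronal η₄ ∂ₜ (Set.range fGraph) := by
  rw [range_fGraph]
  intro p hp q hq hqI
  rw [LorentzianMetric.mem_chronologicalFuture_iff] at hqI
  obtain ⟨p', hp', γ, a, b, hab, hγ, hγa, hγb⟩ := hqI
  rw [Set.mem_singleton_iff] at hp'
  subst hp'
  have hmono := Minkowski.strictMonoOn_time_of_isFutureCausalCurveOn (ordConnected_Icc (a := a) (b := b))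
    hγ.isFutureCausalCurveOn
  have ha : a ∈ Icc a b := left_mem_Icc.mpr hab.le
  have hb : b ∈ Icc a b := right_mem_Icc.mpr hab.le
  have htime : γ a 0 < γ b 0 := hmono ha hb hab
  have hsp := Minkowski.norm_spatial_sub_le_of_isFutureCausalCurveOn (ordConnected_Icc (a := a) (b := b))
    hγ.isFutureCausalCurveOn ha hb hab.le
  rw [hγa, hγb] at htime hsp
  -- graph relations
  have hp0 : p' 0 = uprof (p' 1) := hp
  have hq0 : q 0 = uprof (q 1) := hq
  have hcoord : |q 1 - p' 1| ≤ ‖E4.spatial q - E4.spatial p'‖ := by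
    have := abs_apply_le_norm_E3 (E4.spatial q - E4.spatial p') 0
    simpa [E4.spatial] using this
  by_cases h1 : q 1 = p' 1
  · rw [hq0, hp0, h1] at htime
    exact lt_irrefl _ htime
  · have hlt := abs_uprof_sub_lt h1
    have : q 0 - p' 0 ≤ |uprof (q 1) - uprof (p' 1)| := by
      rw [hq0, hp0]; exact le_abs_self _
    linarith

section Final

variable [Minkowski.smoothMetric.toPseudoRiemannianMetric.HasLeviCivita]

local notation "gη" => (Minkowski.smoothMetric.toPseudoRiemannianMetric :
  PseudoRiemannianMetric 𝓘(ℝ, E4) ∞ E4 (TangentSpace 𝓘(ℝ, E4) : E4 → Type _))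

omit [Minkowski.smoothMetric.toPseudoRiemannianMetric.HasLeviCivita] in
/-- **`ν` is the future unit normal of the graph.** -/
theorem isFutureUnitNormal_νf : LorentzianMetric.IsFutureUnitNormal (𝓡 3) η₄ ∂ₜ fGraph νf := by
  refine ⟨⟨fun y v ↦ ?_, fun y ↦ ?_⟩, fun y ↦ ⟨⟨?_, ?_⟩, ?_⟩⟩
  · show Minkowski.bilin (Nf y) (mfderiv 𝓘(ℝ, E3) 𝓘(ℝ, E4) fGraph y v) = 0
    rw [mfderiv_fGraph]; exact bilin_Nf_dfGraph y v
  · show Minkowski.bilin (Nf y) (Nf y) = -1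
    exact bilin_Nf_Nf y
  · show Minkowski.bilin (Nf y) (Nf y) ≤ 0
    rw [bilin_Nf_Nf]; norm_num
  · show Nf y ≠ 0
    intro h
    have := bilin_Nf_Nf y
    rw [h, map_zero] at this
    norm_num at this
  · show Minkowski.bilin (E4.basisVector 0) (Nf y) < 0
    exact bilin_e0_Nf y

omit [Minkowski.smoothMetric.toPseudoRiemannianMetric.HasLeviCivita] in
/-- The base point `q₀ = (0, −1, 0, 0)` of the null line (`q₀⁰ + q₀¹ = −1 < 0`). -/
def qBase : E4 := -E4.basisVector 1

omit [Minkowski.smoothMetric.toPseudoRiemannianMetric.HasLeviCivita] in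
/-- `q₀⁰ + q₀¹ = −1 < 0`. -/
theorem qBase_sum : qBase 0 + qBase 1 < 0 := by
  simp [qBase]

/-- The null line is a maximal geodesic of the flat development on `ℝ`. -/
theorem isMaximalGeodesicOn_nullLine :
    IsMaximalGeodesicOn (PseudoRiemannianMetric.leviCivita gη) (nullLine qBase) Set.univ :=
  (isGeodesic_nullLine qBase).isMaximalGeodesicOn_univ

omit [Minkowski.smoothMetric.toPseudoRiemannianMetric.HasLeviCivita] in
/-- The null line is null and future-directed (at every parameter). -/
theorem isNull_velocity_nullLine (t : ℝ) :
    LorentzianMetric.IsNull η₄ (velocity (𝓡 4) (nullLine qBase) t) ∧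
      TimeOrientation.IsFutureDirected ∂ₜ (velocity (𝓡 4) (nullLine qBase) t) := by
  have hv : velocity (𝓡 4) (nullLine qBase) t = nullDir := velocity_nullLine qBase t
  rw [hv]
  have hne : nullDir ≠ 0 := fun h ↦ by simpa using congrArg (fun v : E4 ↦ v 0) h
  refine ⟨⟨bilin_nullDir_nullDir, hne⟩, ⟨bilin_nullDir_nullDir.le, hne⟩, ?_⟩
  show Minkowski.bilin (E4.basisVector 0) nullDir < 0
  rw [Minkowski.bilin_basisVector_zero_left, nullDir_apply_zero]
  norm_num

omit [Minkowski.smoothMetric.toPseudoRiemannianMetric.HasLeviCivita] in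
/-- **The null line is eventually inside the faithful `D⁺` of the graph** (for parameters `t ≥ 0`). -/
theorem nullLine_mem_fdod {t : ℝ} (ht : 0 ≤ t) :
    nullLine qBase t ∈ {p : E4 | ∀ (β : ℝ → E4) (s : Set ℝ), s.OrdConnected →
      LorentzianMetric.IsFutureCausalCurveOn η₄ ∂ₜ β s → IsPastEndless β s →
      ∀ t₀ ∈ s, β t₀ = p → ∃ t ∈ s, t ≤ t₀ ∧ β t ∈ Set.range fGraph} := by
  intro β s hs hβ hend t₀ ht₀ hβp
  rw [range_fGraph]
  have hq0 : -qBase 0 ≤ t := by simpa [qBase, Fin.ext_iff] using ht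
  exact regionW_subset_fdod_graph (nullLine_mem_regionW qBase_sum hq0) β s hs hβ hend ht₀ hβp

end Final

/-! ## The refutations -/

/-- `NullTerminality` of the skeleton with UNIFORM contraction `∃ ε > 0, ∀ y, H y ≤ −ε` weakened to
POINTWISE contraction `∀ y, H y < 0` (everything else verbatim, faithful `D⁺` inlined). -/
def NullTerminalityPointwise : Prop :=
  ∀ (Y : Type) [TopologicalSpace Y] [ChartedSpace E3 Y] [IsManifold (𝓡 3) ∞ Y] [T2Space Y]
    [SecondCountableTopology Y] [ConnectedSpace Y] (DY : InitialDataSet (𝓡 3) Y)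
    (𝒟 : VacuumCauchyDevelopment DY), 𝒟.IsMaximal → ∀ [𝒟.metric.HasLeviCivita]
    (N : Type) [TopologicalSpace N] [ChartedSpace E3 N] [IsManifold (𝓡 3) ∞ N] (f : N → 𝒟.carrier)
    (hpb : PseudoRiemannianMetric.contMDiff_pullbackBilin (𝓡 4) 𝒟.carrier (𝓡 3) N ∞)
    (hf : 𝒟.metric.IsSpacelikeImmersion (𝓡 3) f) (ν : NormalField (𝓡 4) f),
    ContMDiff (𝓡 3) (𝓡 4).tangent ∞
      (fun y ↦ (TotalSpace.mk' E4 (f y) (ν y) : TangentBundle (𝓡 4) 𝒟.carrier)) →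
    𝒟.metric.IsFutureUnitNormal (𝓡 3) 𝒟.timeOrientation f ν →
    IsClosed (Set.range f) → 𝒟.metric.IsAchronal 𝒟.timeOrientation (Set.range f) →
    (∀ y, 𝒟.metric.meanCurvature f hpb hf ν y < 0) →
    ∀ (γ : ℝ → 𝒟.carrier) (dom : Set ℝ), IsMaximalGeodesicOn 𝒟.metric.leviCivita γ dom →
      (∃ t ∈ dom, 𝒟.metric.IsNull (velocity (𝓡 4) γ t) ∧
        𝒟.timeOrientation.IsFutureDirected (velocity (𝓡 4) γ t)) →
      (∃ t₀ ∈ dom, ∀ t ∈ dom, t₀ ≤ t →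
        γ t ∈ {p : 𝒟.carrier | ∀ (β : ℝ → 𝒟.carrier) (s : Set ℝ), s.OrdConnected →
          𝒟.metric.IsFutureCausalCurveOn 𝒟.timeOrientation β s → IsPastEndless β s →
          ∀ t₀ ∈ s, β t₀ = p → ∃ t ∈ s, t ≤ t₀ ∧ β t ∈ Set.range f}) →
      BddAbove dom

/-- The same without the maximality hypothesis on the development (refuted unconditionally below). -/
def NullTerminalityPointwiseAnyDev : Prop :=
  ∀ (Y : Type) [TopologicalSpace Y] [ChartedSpace E3 Y] [IsManifold (𝓡 3) ∞ Y] [T2Space Y]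
    [SecondCountableTopology Y] [ConnectedSpace Y] (DY : InitialDataSet (𝓡 3) Y)
    (𝒟 : VacuumCauchyDevelopment DY), ∀ [𝒟.metric.HasLeviCivita]
    (N : Type) [TopologicalSpace N] [ChartedSpace E3 N] [IsManifold (𝓡 3) ∞ N] (f : N → 𝒟.carrier)
    (hpb : PseudoRiemannianMetric.contMDiff_pullbackBilin (𝓡 4) 𝒟.carrier (𝓡 3) N ∞)
    (hf : 𝒟.metric.IsSpacelikeImmersion (𝓡 3) f) (ν : NormalField (𝓡 4) f),
    ContMDiff (𝓡 3) (𝓡 4).tangent ∞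
      (fun y ↦ (TotalSpace.mk' E4 (f y) (ν y) : TangentBundle (𝓡 4) 𝒟.carrier)) →
    𝒟.metric.IsFutureUnitNormal (𝓡 3) 𝒟.timeOrientation f ν →
    IsClosed (Set.range f) → 𝒟.metric.IsAchronal 𝒟.timeOrientation (Set.range f) →
    (∀ y, 𝒟.metric.meanCurvature f hpb hf ν y < 0) →
    ∀ (γ : ℝ → 𝒟.carrier) (dom : Set ℝ), IsMaximalGeodesicOn 𝒟.metric.leviCivita γ dom →
      (∃ t ∈ dom, 𝒟.metric.IsNull (velocity (𝓡 4) γ t) ∧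
        𝒟.timeOrientation.IsFutureDirected (velocity (𝓡 4) γ t)) →
      (∃ t₀ ∈ dom, ∀ t ∈ dom, t₀ ≤ t →
        γ t ∈ {p : 𝒟.carrier | ∀ (β : ℝ → 𝒟.carrier) (s : Set ℝ), s.OrdConnected →
          𝒟.metric.IsFutureCausalCurveOn 𝒟.timeOrientation β s → IsPastEndless β s →
          ∀ t₀ ∈ s, β t₀ = p → ∃ t ∈ s, t ≤ t₀ ∧ β t ∈ Set.range f}) →
      BddAbove dom

/-- **Core**: the `𝒟 = Minkowski` instance of pointwise null terminality is false — witness the graph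
`t = −log(1 + e^{x¹})` and the null line through `(0, −1, 0, 0)` with direction `e₀ − e₁`. -/
theorem nullTerminalityPointwise_minkowski_false
    (h : ∀ [Minkowski.vacuumCauchyDevelopment.metric.HasLeviCivita]
      (N : Type) [TopologicalSpace N] [ChartedSpace E3 N] [IsManifold (𝓡 3) ∞ N]
      (f : N → Minkowski.vacuumCauchyDevelopment.carrier)
      (hpb : PseudoRiemannianMetric.contMDiff_pullbackBilin (𝓡 4)
        Minkowski.vacuumCauchyDevelopment.carrier (𝓡 3) N ∞)
      (hf : Minkowski.vacuumCauchyDevelopment.metric.IsSpacelikeImmersion (𝓡 3) f)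
      (ν : NormalField (𝓡 4) f),
      ContMDiff (𝓡 3) (𝓡 4).tangent ∞
        (fun y ↦ (TotalSpace.mk' E4 (f y) (ν y) :
          TangentBundle (𝓡 4) Minkowski.vacuumCauchyDevelopment.carrier)) →
      Minkowski.vacuumCauchyDevelopment.metric.IsFutureUnitNormal (𝓡 3)
        Minkowski.vacuumCauchyDevelopment.timeOrientation f ν →
      IsClosed (Set.range f) →
      Minkowski.vacuumCauchyDevelopment.metric.IsAchronal
        Minkowski.vacuumCauchyDevelopment.timeOrientation (Set.range f) →
      (∀ y, Minkowski.vacuumCauchyDevelopment.metric.meanCurvature f hpb hf ν y < 0) →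
      ∀ (γ : ℝ → Minkowski.vacuumCauchyDevelopment.carrier) (dom : Set ℝ),
        IsMaximalGeodesicOn Minkowski.vacuumCauchyDevelopment.metric.leviCivita γ dom →
        (∃ t ∈ dom, Minkowski.vacuumCauchyDevelopment.metric.IsNull (velocity (𝓡 4) γ t) ∧
          Minkowski.vacuumCauchyDevelopment.timeOrientation.IsFutureDirected (velocity (𝓡 4) γ t)) →
        (∃ t₀ ∈ dom, ∀ t ∈ dom, t₀ ≤ t →
          γ t ∈ {p : Minkowski.vacuumCauchyDevelopment.carrier |
            ∀ (β : ℝ → Minkowski.vacuumCauchyDevelopment.carrier) (s : Set ℝ), s.OrdConnected →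
            Minkowski.vacuumCauchyDevelopment.metric.IsFutureCausalCurveOn
              Minkowski.vacuumCauchyDevelopment.timeOrientation β s → IsPastEndless β s →
            ∀ t₀ ∈ s, β t₀ = p → ∃ t ∈ s, t ≤ t₀ ∧ β t ∈ Set.range f}) →
        BddAbove dom) : False := by
  haveI hLC : Minkowski.smoothMetric.toPseudoRiemannianMetric.HasLeviCivita :=
    PseudoRiemannianMetric.hasLeviCivita _
  have hbdd := @h hLC E3 _ _ _ fGraph hpbE isSpacelikeImmersion_fGraph νf contMDiff_lift
    isFutureUnitNormal_νf isClosed_range_fGraph isAchronal_range_fGraph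
    meanCurvature_fGraph_neg (nullLine qBase) Set.univ isMaximalGeodesicOn_nullLine
    ⟨0, Set.mem_univ _, isNull_velocity_nullLine 0⟩
    ⟨0, Set.mem_univ _, fun t _ ht ↦ nullLine_mem_fdod ht⟩
  exact not_bddAbove_univ hbdd

/-- **Pointwise null terminality fails in SOME vacuum Cauchy development** (Minkowski's): the
maximality-free variant is false unconditionally. -/
theorem not_nullTerminalityPointwiseAnyDev : ¬ NullTerminalityPointwiseAnyDev := fun h ↦
  nullTerminalityPointwise_minkowski_false (h Minkowski.slice trivialData
    Minkowski.vacuumCauchyDevelopment)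

/-- **Pointwise null terminality (verbatim the skeleton's `NullTerminality` with `H ≤ −ε` weakened to
`H < 0`) is false, modulo maximality of the Minkowski development** (the tree's standing MGHD gap:
uniqueness of the MGHD of the trivial datum is not formalised). ANY proof of the skeleton's
`NullTerminality` must therefore use the uniform bound `ε > 0` quantitatively. -/
theorem not_nullTerminalityPointwise_of_isMaximal
    (hmax : Minkowski.vacuumCauchyDevelopment.IsMaximal) : ¬ NullTerminalityPointwise := fun h ↦
  nullTerminalityPointwise_minkowski_false (h Minkowski.slice trivialData
    Minkowski.vacuumCauchyDevelopment hmax)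

end Summit.FinalStateConjecture.FinalStateConjecture.Cruxes.TameCensorship.Disproof.Uniformity

end
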